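import Mathlib.Analysis.InnerProductSpace.Dual
import Mathlib.Analysis.Convex.Continuous
import Mathlib.Analysis.LocallyConvex.Separation
import Mathlib.Analysis.Calculus.FDeriv.Comp
import Mathlib.Analysis.Calculus.Deriv.Comp
import Mathlib.Analysis.Calculus.Deriv.Mul
import Mathlib.Analysis.Calculus.Deriv.Add
import Mathlib.Analysis.Calculus.Deriv.Slope
import HarnessLib

/-!
# Subgradients of convex functions on a real inner product space

For `f : E → ℝ` on a real inner product space, a set `s ⊆ E` and points `p x : E`,
`HasSubgradientWithinAt f s p x` means that the affine function `y ↦ f x + ⟪p, y - x⟫` minorises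
`f` on `s` and touches it at `x`; `subdifferentialWithin f s x` is the set of such `p` (the
*subdifferential* `∂f(x)` relative to `s`). This is the basic object of convex analysis
(Rockafellar 1970, §23; Evans–Gariepy 1992, §6.3) and the tool by which Alexandrov's theorem on
the second differentiability of convex functions (Evans–Gariepy, Thm. 6.9) is to be proved (brick
of `Literature.Geometry.Lorentzian.ChruscielEtAl2001_areaTheorem`, whose printed proof rests on
Chruściel–Delay–Galloway–Howard 2001, Prop. 2.1 = Alexandrov's theorem). Locators below refer to
the held copy of Hiriart-Urruty–Lemaréchal, *Fundamentals of Convex Analysis* (2001), Chap. D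
("Subdifferentials of finite convex functions"), where everything is done for finite convex
functions on `ℝⁿ`; here the ambient space is any real inner product space and the subdifferential
is taken relative to a set `s`.

## Main results (all proved)

* `convex_subdifferentialWithin`, `isClosed_subdifferentialWithin`;
* `HasSubgradientWithinAt.inner_sub_nonneg` — monotonicity of the subdifferential:
  `⟪p - q, x - y⟫ ≥ 0` for `p ∈ ∂f(x)`, `q ∈ ∂f(y)` (Rockafellar 1970, §24);
* `HasSubgradientWithinAt.norm_le` — on a ball where `f - f x ≤ L‖· - x‖`, subgradients at `x` have
  norm `≤ L` (local boundedness of `∂f`);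
* `ConvexOn.apply_add_fderiv_le`, `ConvexOn.hasSubgradientWithinAt_of_hasFDerivAt` — the
  differential of a convex function at a point of `s` is a subgradient (first-order
  characterisation of convexity);
* `HasSubgradientWithinAt.inner_eq_of_hasFDerivAt` — at an interior point of differentiability the
  subgradient is unique, `⟪p, v⟫ = f'(x) v`;
* `hasSubgradientWithinAt_of_tendsto` — closedness of the graph of `∂f` along limits, for `f`
  continuous within `s`;
* `ConvexOn.exists_hasSubgradientWithinAt` — **existence**: a convex function continuous on an open
  convex set `s` has a subgradient at every point of `s` (supporting hyperplane to the open strict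
  epigraph, `geometric_hahn_banach_open_point`, and the Riesz representation
  `InnerProductSpace.toDual`); in finite dimension continuity is automatic
  (`ConvexOn.exists_hasSubgradientWithinAt_of_finiteDimensional`).

## References

* J.-B. Hiriart-Urruty, C. Lemaréchal, *Fundamentals of Convex Analysis*, Springer 2001, Chap. D:
  Def. 1.1.4 and Def. 1.2.1 (subdifferential; held copy PDF pp. 166–167), Thm. 1.2.2 (p. 168),
  Cor. 2.1.4 (p. 174), Prop. 6.1.1 (monotonicity, p. 195), Prop. 6.2.1–6.2.2 (closed graph, local
  boundedness, p. 197); Chap. B, Thm. 4.1.1 (first-order characterisation, p. 116). Key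
  `HiriarturrutyLemarechal2001`.
* R. T. Rockafellar, *Convex Analysis*, Princeton 1970, §§23–25 (the classical source). Key
  `Rockafellar1970`.
* L. C. Evans, R. F. Gariepy, *Measure Theory and Fine Properties of Functions*, CRC 1992, §6.3
  (held copy, revised edition, PDF p. 151: proof of Thm. 6.7, step 3, the first-order inequality
  `f(y) ≥ f(x) + Df(x)·(y - x)`). Key `EvansGariepy1992`.
-/

noncomputable section

open Set Filter Metric Topology InnerProductSpace
open scoped RealInnerProductSpace

namespace Literature.Analysis.Convex

variable {E : Type*} [NormedAddCommGroup E] [InnerProductSpace ℝ E]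

/-! ### Definitions -/

/-- `p` is a **subgradient** of `f : E → ℝ` at `x` relative to the set `s`: the affine function
`y ↦ f x + ⟪p, y - x⟫` is below `f` on `s` (Hiriart-Urruty–Lemaréchal 2001, Chap. D, Def. 1.2.1,
"Subdifferential II": the vectors `s` satisfying `f(y) ≥ f(x) + ⟨s, y - x⟩` for all `y`; here
relative to a set `s`). No convexity is assumed in the definition.
[cite: HiriarturrutyLemarechal2001, Chap. D, Def. 1.2.1 (PDF p. 167)] -/
def HasSubgradientWithinAt (f : E → ℝ) (s : Set E) (p x : E) : Prop :=
  ∀ y ∈ s, f x + ⟪p, y - x⟫ ≤ f y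

/-- The **subdifferential** `∂f(x)` of `f` at `x` relative to `s`: the set of all subgradients
(Hiriart-Urruty–Lemaréchal 2001, Chap. D, Def. 1.2.1).
[cite: HiriarturrutyLemarechal2001, Chap. D, Def. 1.2.1 (PDF p. 167)] -/
def subdifferentialWithin (f : E → ℝ) (s : Set E) (x : E) : Set E :=
  {p | HasSubgradientWithinAt f s p x}

variable {f : E → ℝ} {s t : Set E} {p q x y : E}

/-- Unfolding lemma. [folklore] -/
theorem hasSubgradientWithinAt_iff :
    HasSubgradientWithinAt f s p x ↔ ∀ y ∈ s, f x + ⟪p, y - x⟫ ≤ f y := Iff.rfl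

/-- Unfolding lemma. [folklore] -/
@[simp] theorem mem_subdifferentialWithin_iff :
    p ∈ subdifferentialWithin f s x ↔ HasSubgradientWithinAt f s p x := Iff.rfl

/-- Restricting the set keeps subgradients. [folklore] -/
theorem HasSubgradientWithinAt.mono (h : HasSubgradientWithinAt f s p x) (hts : t ⊆ s) :
    HasSubgradientWithinAt f t p x := fun y hy ↦ h y (hts hy)

/-- The subgradient inequality in the form `⟪p, y - x⟫ ≤ f y - f x`. [folklore] -/
theorem HasSubgradientWithinAt.inner_le (h : HasSubgradientWithinAt f s p x) (hy : y ∈ s) :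
    ⟪p, y - x⟫ ≤ f y - f x := by linarith [h y hy]

/-- The subdifferential is convex (an intersection of half-spaces). Hiriart-Urruty–Lemaréchal 2001,
Chap. D, Def. 1.1.4 with Thm. 1.2.2 ("the nonempty compact convex set"; here: convexity).
[cite: HiriarturrutyLemarechal2001, Chap. D, Def. 1.1.4 (PDF p. 166)] -/
theorem convex_subdifferentialWithin (f : E → ℝ) (s : Set E) (x : E) :
    Convex ℝ (subdifferentialWithin f s x) := by
  intro p hp q hq a b ha hb hab y hy
  have h1 : f x + ⟪p, y - x⟫ ≤ f y := hp y hy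
  have h2 : f x + ⟪q, y - x⟫ ≤ f y := hq y hy
  show f x + ⟪a • p + b • q, y - x⟫ ≤ f y
  have : ⟪a • p + b • q, y - x⟫ = a * ⟪p, y - x⟫ + b * ⟪q, y - x⟫ := by
    rw [inner_add_left, real_inner_smul_left, real_inner_smul_left]
  rw [this]
  have h1' := mul_le_mul_of_nonneg_left h1 ha
  have h2' := mul_le_mul_of_nonneg_left h2 hb
  have e1 : a * f y + b * f y = f y := by rw [← add_mul, hab, one_mul]
  have e2 : a * f x + b * f x = f x := by rw [← add_mul, hab, one_mul]
  linarith [h1', h2', e1, e2]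

/-- The subdifferential is closed (an intersection of closed half-spaces). Hiriart-Urruty–Lemaréchal
2001, Chap. D, Def. 1.1.4 with Thm. 1.2.2 (compactness in `ℝⁿ`; here: closedness).
[cite: HiriarturrutyLemarechal2001, Chap. D, Def. 1.1.4 (PDF p. 166)] -/
theorem isClosed_subdifferentialWithin (f : E → ℝ) (s : Set E) (x : E) :
    IsClosed (subdifferentialWithin f s x) := by
  have : subdifferentialWithin f s x = ⋂ y ∈ s, {p : E | f x + ⟪p, y - x⟫ ≤ f y} := by
    ext p
    simp only [mem_subdifferentialWithin_iff, hasSubgradientWithinAt_iff, mem_iInter, mem_setOf_eq]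
  rw [this]
  refine isClosed_biInter fun y _ ↦ ?_
  exact isClosed_le (continuous_const.add (continuous_id.inner continuous_const)) continuous_const

/-! ### Monotonicity and local boundedness -/

/-- **Monotonicity of the subdifferential**: for subgradients `p` at `x` and `q` at `y` (both
points in `s`), `0 ≤ ⟪p - q, x - y⟫` — add the two subgradient inequalities.
Hiriart-Urruty–Lemaréchal 2001, Chap. D, Prop. 6.1.1 ("The subdifferential mapping is monotone").
[cite: HiriarturrutyLemarechal2001, Chap. D, Prop. 6.1.1 (PDF p. 195)] -/
theorem HasSubgradientWithinAt.inner_sub_nonneg (hp : HasSubgradientWithinAt f s p x)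
    (hq : HasSubgradientWithinAt f s q y) (hx : x ∈ s) (hy : y ∈ s) :
    0 ≤ ⟪p - q, x - y⟫ := by
  have h1 : f x + ⟪p, y - x⟫ ≤ f y := hp y hy
  have h2 : f y + ⟪q, x - y⟫ ≤ f x := hq x hx
  have e1 : ⟪p - q, x - y⟫ = -⟪p, y - x⟫ - ⟪q, x - y⟫ := by
    rw [inner_sub_left, ← neg_sub y x, inner_neg_right]
  linarith

/-- **Local boundedness of subgradients**: if `f y - f x ≤ L ‖y - x‖` on a ball `ball x r ⊆ s`
with `L ≥ 0` (e.g. `f` is `L`-Lipschitz near `x`), then every subgradient of `f` at `x` has norm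
at most `L`. Hiriart-Urruty–Lemaréchal 2001, Chap. D, Prop. 6.2.2 ("The mapping `∂f` is locally
bounded"; same proof: test the subgradient inequality at `x + (r/2) p/‖p‖`).
[cite: HiriarturrutyLemarechal2001, Chap. D, Prop. 6.2.2 (PDF p. 197)] -/
theorem HasSubgradientWithinAt.norm_le (hp : HasSubgradientWithinAt f s p x) {r L : ℝ}
    (hr : 0 < r) (hL0 : 0 ≤ L) (hball : ball x r ⊆ s)
    (hL : ∀ y ∈ ball x r, f y - f x ≤ L * ‖y - x‖) : ‖p‖ ≤ L := by
  by_cases hp0 : p = 0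
  · rw [hp0, norm_zero]; exact hL0
  · have hpn : 0 < ‖p‖ := norm_pos_iff.mpr hp0
    set y : E := x + (r / 2 / ‖p‖) • p with hy
    have hyx : y - x = (r / 2 / ‖p‖) • p := by rw [hy, add_sub_cancel_left]
    have hnorm : ‖y - x‖ = r / 2 := by
      rw [hyx, norm_smul, Real.norm_of_nonneg (by positivity)]
      field_simp
    have hyb : y ∈ ball x r := by
      rw [mem_ball, dist_eq_norm, hnorm]; linarith
    have h1 := hL y hyb
    have h2 := hp.inner_le (hball hyb)
    rw [hyx, real_inner_smul_right, real_inner_self_eq_norm_sq] at h2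
    rw [hnorm] at h1
    have h3 : r / 2 / ‖p‖ * ‖p‖ ^ 2 = (r / 2) * ‖p‖ := by
      field_simp
    rw [h3] at h2
    nlinarith

/-! ### Subgradients and derivatives -/

/-- **The differential of a convex function is a subgradient** (first-order characterisation of
convexity): if `f` is convex on `s` and has Fréchet derivative `f'` at `x ∈ s`, then
`f x + f' (y - x) ≤ f y` for every `y ∈ s`. Proof: the slope `(f(x + t(y - x)) - f x)/t` is at
most `f y - f x` for `t ∈ (0, 1)` by convexity and tends to `f' (y - x)` as `t → 0⁺` (Evans–Gariepy,
proof of Thm. 6.7, step 3). Hiriart-Urruty–Lemaréchal 2001, Chap. B, Thm. 4.1.1 (i) and Chap. D,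
Cor. 2.1.4. [cite: HiriarturrutyLemarechal2001, Chap. B, Thm. 4.1.1 (PDF p. 116)] -/
theorem ConvexOn.apply_add_fderiv_le (hf : ConvexOn ℝ s f) (hx : x ∈ s) {f' : E →L[ℝ] ℝ}
    (hd : HasFDerivAt f f' x) (hy : y ∈ s) : f x + f' (y - x) ≤ f y := by
  -- the restriction to the segment
  set g : ℝ → ℝ := fun t ↦ f (x + t • (y - x)) with hg
  have hgd : HasDerivAt g (f' (y - x)) 0 := by
    have hline : HasDerivAt (fun t : ℝ ↦ x + t • (y - x)) (y - x) 0 := by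
      simpa using ((hasDerivAt_id (0 : ℝ)).smul_const (y - x)).const_add x
    have hd' : HasFDerivAt f f' (x + (0 : ℝ) • (y - x)) := by simpa using hd
    exact hd'.comp_hasDerivAt 0 hline
  -- slopes are bounded by `f y - f x` on `(0, 1)`
  have hslope : ∀ t ∈ Ioo (0 : ℝ) 1, t⁻¹ • (g (0 + t) - g 0) ≤ f y - f x := by
    intro t ht
    have hconv := hf.2 hx hy (by linarith [ht.2] : 0 ≤ 1 - t) ht.1.le (by ring)
    have hpt : (1 - t) • x + t • y = x + t • (y - x) := by
      simp only [sub_smul, one_smul, smul_sub]; abel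
    rw [hpt] at hconv
    have hg0 : g 0 = f x := by simp [hg]
    have hgt : g (0 + t) = f (x + t • (y - x)) := by simp [hg]
    rw [hg0, hgt, smul_eq_mul, ← div_eq_inv_mul, div_le_iff₀ ht.1]
    simp only [smul_eq_mul] at hconv
    nlinarith [hconv, ht.1]
  -- pass to the limit `t → 0⁺`
  have htend : Tendsto (fun t ↦ t⁻¹ • (g (0 + t) - g 0)) (𝓝[>] 0) (𝓝 (f' (y - x))) :=
    hgd.tendsto_slope_zero_right
  have hmem : Ioo (0 : ℝ) 1 ∈ 𝓝[>] (0 : ℝ) := Ioo_mem_nhdsGT zero_lt_one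
  have hle : f' (y - x) ≤ f y - f x :=
    le_of_tendsto htend (by filter_upwards [hmem] with t ht using hslope t ht)
  linarith

/-- In the language of subgradients: for `f` convex on `s` with Fréchet derivative `f'` at `x ∈ s`,
the Riesz representative of `f'` is a subgradient of `f` at `x` relative to `s`.
Hiriart-Urruty–Lemaréchal 2001, Chap. D, Cor. 2.1.4 ("if the convex `f` is differentiable at `x`, its
only subgradient at `x` is its gradient"). [cite: HiriarturrutyLemarechal2001, Chap. D, Cor. 2.1.4 (PDF p. 174)] -/
theorem ConvexOn.hasSubgradientWithinAt_of_hasFDerivAt [CompleteSpace E] (hf : ConvexOn ℝ s f)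
    (hx : x ∈ s) {f' : E →L[ℝ] ℝ} (hd : HasFDerivAt f f' x) :
    HasSubgradientWithinAt f s ((toDual ℝ E).symm f') x := fun y hy ↦ by
  rw [toDual_symm_apply]
  exact ConvexOn.apply_add_fderiv_le hf hx hd hy

/-- **Uniqueness of the subgradient at interior points of differentiability**: if `f` has Fréchet
derivative `f'` at a point `x` with `s ∈ 𝓝 x` and `p` is a subgradient there, then
`⟪p, v⟫ = f' v` for every `v` (so `p` is the gradient). Proof: compare the subgradient inequality
along `x + t (± v)` with the first-order expansion. Hiriart-Urruty–Lemaréchal 2001, Chap. D,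
Cor. 2.1.4. [cite: HiriarturrutyLemarechal2001, Chap. D, Cor. 2.1.4 (PDF p. 174)] -/
theorem HasSubgradientWithinAt.inner_eq_of_hasFDerivAt (hp : HasSubgradientWithinAt f s p x)
    (hx : s ∈ 𝓝 x) {f' : E →L[ℝ] ℝ} (hd : HasFDerivAt f f' x) (v : E) : ⟪p, v⟫ = f' v := by
  -- one-sided inequality `⟪p, w⟫ ≤ f' w` for every `w`, then apply it to `± v`
  suffices key : ∀ w : E, ⟪p, w⟫ ≤ f' w by
    have h1 := key v
    have h2 := key (-v)
    rw [inner_neg_right, map_neg] at h2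
    linarith
  intro w
  set g : ℝ → ℝ := fun t ↦ f (x + t • w) with hg
  have hgd : HasDerivAt g (f' w) 0 := by
    have hline : HasDerivAt (fun t : ℝ ↦ x + t • w) w 0 := by
      simpa using ((hasDerivAt_id (0 : ℝ)).smul_const w).const_add x
    have hd' : HasFDerivAt f f' (x + (0 : ℝ) • w) := by simpa using hd
    exact hd'.comp_hasDerivAt 0 hline
  have htend : Tendsto (fun t ↦ t⁻¹ • (g (0 + t) - g 0)) (𝓝[>] 0) (𝓝 (f' w)) :=
    hgd.tendsto_slope_zero_right
  -- `x + t • w ∈ s` for small `t`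
  have hcont : Tendsto (fun t : ℝ ↦ x + t • w) (𝓝 0) (𝓝 x) := by
    have : Continuous (fun t : ℝ ↦ x + t • w) :=
      continuous_const.add (continuous_id.smul continuous_const)
    simpa using this.tendsto 0
  have hmem : ∀ᶠ t in 𝓝[>] (0 : ℝ), x + t • w ∈ s :=
    nhdsWithin_le_nhds (hcont.eventually_mem hx)
  refine ge_of_tendsto htend ?_
  filter_upwards [hmem, self_mem_nhdsWithin] with t hts ht
  have h1 := hp.inner_le hts
  rw [add_sub_cancel_left, real_inner_smul_right] at h1
  have ht0 : 0 < t := ht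
  have hg0 : g 0 = f x := by simp [hg]
  have hgt : g (0 + t) = f (x + t • w) := by simp [hg]
  rw [hg0, hgt, smul_eq_mul, ← div_eq_inv_mul, le_div_iff₀ ht0]
  linarith

/-! ### Closedness of the graph -/

/-- **Limits of subgradients are subgradients** (closedness of the graph of `∂f`): if `y i → x`
within `s`, `q i → p`, `q i` is a subgradient at `y i` eventually, and `f` is continuous within
`s` at `x`, then `p` is a subgradient at `x`. Hiriart-Urruty–Lemaréchal 2001, Chap. D, Prop. 6.2.1
("The graph of its subdifferential mapping is closed"; same proof: pass to the limit in the
subgradient inequality). [cite: HiriarturrutyLemarechal2001, Chap. D, Prop. 6.2.1 (PDF p. 197)] -/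
theorem hasSubgradientWithinAt_of_tendsto {ι : Type*} {l : Filter ι} [l.NeBot] {yi : ι → E}
    {qi : ι → E} (hy : Tendsto yi l (𝓝[s] x)) (hq : Tendsto qi l (𝓝 p))
    (hsub : ∀ᶠ i in l, HasSubgradientWithinAt f s (qi i) (yi i))
    (hcont : ContinuousWithinAt f s x) : HasSubgradientWithinAt f s p x := by
  intro z hz
  have hfz : ∀ᶠ i in l, f (yi i) + ⟪qi i, z - yi i⟫ ≤ f z := hsub.mono fun i hi ↦ hi z hz
  have hyx : Tendsto yi l (𝓝 x) := (tendsto_nhdsWithin_iff.mp hy).1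
  have h1 : Tendsto (fun i ↦ f (yi i)) l (𝓝 (f x)) := hcont.tendsto.comp hy
  have h2 : Tendsto (fun i ↦ ⟪qi i, z - yi i⟫) l (𝓝 ⟪p, z - x⟫) :=
    hq.inner (tendsto_const_nhds.sub hyx)
  exact le_of_tendsto (h1.add h2) hfz

/-! ### Existence of subgradients -/

/-- **Existence of subgradients** (supporting hyperplane theorem): a convex function which is
continuous on an open (convex) set `s` has a subgradient, relative to `s`, at every point of `s`.
Proof: the strict epigraph `{(y, t) : y ∈ s, f y < t}` is open and convex and misses `(x, f x)`;
a separating functional `φ` (`geometric_hahn_banach_open_point`) has `φ(0, 1) < 0`, and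
`-φ(·, 0)/φ(0, 1)`, represented by a vector through the Riesz isomorphism
(`InnerProductSpace.toDual`), is a subgradient. Hiriart-Urruty–Lemaréchal 2001, Chap. D, Def. 1.1.4
with Thm. 1.2.2 (the subdifferential of a finite convex function is nonempty at every point; there
via the directional derivative, here via separation of the epigraph, Chap. A, Thm. 4.1.1).
[cite: HiriarturrutyLemarechal2001, Chap. D, Thm. 1.2.2 (PDF p. 168)] -/
theorem ConvexOn.exists_hasSubgradientWithinAt [CompleteSpace E] (hf : ConvexOn ℝ s f)
    (hs : IsOpen s) (hc : ContinuousOn f s) (hx : x ∈ s) :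
    ∃ p : E, HasSubgradientWithinAt f s p x := by
  -- the open strict epigraph
  set A : Set (E × ℝ) := {z | z.1 ∈ s ∧ f z.1 < z.2} with hA
  have hAconv : Convex ℝ A := hf.convex_strict_epigraph
  have hAopen : IsOpen A := by
    have h1 : ContinuousOn (fun z : E × ℝ ↦ z.2 - f z.1) (s ×ˢ univ) :=
      continuous_snd.continuousOn.sub (hc.comp continuous_fst.continuousOn fun z hz ↦ hz.1)
    have h2 := h1.isOpen_inter_preimage (hs.prod isOpen_univ) isOpen_Ioi (t := Ioi 0)
    have h3 : s ×ˢ univ ∩ (fun z : E × ℝ ↦ z.2 - f z.1) ⁻¹' Ioi 0 = A := by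
      ext z
      simp only [hA, mem_inter_iff, mem_prod, mem_univ, and_true, mem_preimage, mem_Ioi, sub_pos,
        mem_setOf_eq]
    rwa [h3] at h2
  have hxA : ((x, f x) : E × ℝ) ∉ A := fun h ↦ lt_irrefl _ h.2
  obtain ⟨φ, hφ⟩ := geometric_hahn_banach_open_point hAconv hAopen hxA
  -- decompose `φ (y, t) = ψ y + t * c`
  set c : ℝ := φ ((0 : E), (1 : ℝ)) with hcdef
  set ψ : E →L[ℝ] ℝ := φ.comp (ContinuousLinearMap.inl ℝ E ℝ) with hψ
  have hdec : ∀ (y : E) (t : ℝ), φ (y, t) = ψ y + t * c := by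
    intro y t
    have : ((y, t) : E × ℝ) = (y, 0) + t • ((0 : E), (1 : ℝ)) := by simp
    rw [this, map_add, map_smul, smul_eq_mul]
    rfl
  -- `c < 0`, from the point `(x, f x + 1) ∈ A`
  have hc0 : c < 0 := by
    have h := hφ (x, f x + 1) ⟨hx, by simp⟩
    rw [hdec, hdec] at h
    nlinarith
  have hcne : c ≠ 0 := hc0.ne
  have hneg : 0 < -c := by linarith
  -- the candidate subgradient
  refine ⟨(toDual ℝ E).symm ((-c)⁻¹ • ψ), fun y hy ↦ ?_⟩
  rw [toDual_symm_apply]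
  rw [show ((-c)⁻¹ • ψ) (y - x) = (-c)⁻¹ * (ψ y - ψ x) by
    rw [FunLike.coe_smul, Pi.smul_apply, smul_eq_mul, map_sub]]
  -- `ψ y + t c < ψ x + f x * c` for all `t > f y`, hence `ψ y + f y * c ≤ ψ x + f x * c`
  have hlim : ψ y + f y * c ≤ ψ x + f x * c := by
    by_contra hlt
    push Not at hlt
    -- take `t = f y + δ` with `δ * (-c)` smaller than the gap
    set gap := ψ y + f y * c - (ψ x + f x * c) with hgap
    have hgap0 : 0 < gap := by rw [hgap]; linarith
    set δ := gap / (2 * (-c)) with hδ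
    have hδ0 : 0 < δ := by rw [hδ]; exact div_pos hgap0 (by linarith)
    have h := hφ (y, f y + δ) ⟨hy, by simp [hδ0]⟩
    rw [hdec, hdec] at h
    have hδc : δ * (-c) = gap / 2 := by
      rw [hδ]; field_simp
    nlinarith
  rw [← sub_nonneg]
  have key : f y - (f x + (-c)⁻¹ * (ψ y - ψ x)) =
      (-c)⁻¹ * ((ψ x + f x * c) - (ψ y + f y * c)) := by
    have hnc : (-c) ≠ 0 := hneg.ne'
    field_simp
    ring
  rw [key]
  exact mul_nonneg (inv_nonneg.mpr hneg.le) (by linarith)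

/-- **Existence of subgradients in finite dimension**: a convex function on an open convex subset
`s` of a finite-dimensional inner product space has a subgradient at every point of `s`
(continuity is automatic, `ConvexOn.continuousOn`). Hiriart-Urruty–Lemaréchal 2001, Chap. D,
Thm. 1.2.2 with Def. 1.1.4. [cite: HiriarturrutyLemarechal2001, Chap. D, Thm. 1.2.2 (PDF p. 168)] -/
theorem ConvexOn.exists_hasSubgradientWithinAt_of_finiteDimensional [FiniteDimensional ℝ E]
    (hf : ConvexOn ℝ s f) (hs : IsOpen s) (hx : x ∈ s) :
    ∃ p : E, HasSubgradientWithinAt f s p x :=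
  haveI : CompleteSpace E := FiniteDimensional.complete ℝ E
  ConvexOn.exists_hasSubgradientWithinAt hf hs (hf.continuousOn hs) hx

/-- The subdifferential of a convex function at a point of an open convex set in finite dimension
is nonempty. Hiriart-Urruty–Lemaréchal 2001, Chap. D, Def. 1.1.4 with Thm. 1.2.2.
[cite: HiriarturrutyLemarechal2001, Chap. D, Thm. 1.2.2 (PDF p. 168)] -/
theorem ConvexOn.subdifferentialWithin_nonempty [FiniteDimensional ℝ E] (hf : ConvexOn ℝ s f)
    (hs : IsOpen s) (hx : x ∈ s) : (subdifferentialWithin f s x).Nonempty :=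
  ConvexOn.exists_hasSubgradientWithinAt_of_finiteDimensional hf hs hx

end Literature.Analysis.Convex

end
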